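import Summits.QuantumFields.YangMills.Theorems.BalabanUVNodesK0UniformFluxConfig
import Summits.QuantumFields.YangMills.Theorems.BalabanUVNodesK0VariationalThm1GaugeWrap
import Literature.MathematicalPhysics.QuantumFieldTheory.Balaban1983to89.Node00.CriticalOnFibreGauge

/-!
# K0⁶ ROW P11 — FLUX-FLOOR GEOMETRY: the one-parameter diagonal subgroup `D_θ = diag(e^{iθ}, e^{−iθ}, 1, …)` of `SU(N)` (`dist1 (D_θ^n) = |2 sin(nθ∕2)|`) and the bonds of an
# `s × s` Wilson square inside a grid cube (companions: FILE 25A `…K0UniformFluxConfig`, 25C `…K0Gauge152FluxFloor`)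

Cell `pub-ymgap`, seat `pub-ymgap-dag-n21-c` g10 (R134 (a) N21 NE7c s1; K0 ROW P11 negative lane of record).  Filed `--kind proof --supports stmt-QuantumFields-20506 --as helper`.
[15] = [Balaban1985Variational], [6] = [Balaban1985RegularSpaces], [I] = [Balaban1987RG1].

WHAT THIS FILE PROVES (theorems only; no `def`).
§1 ★ `exists_su_diag (hN : 2 ≤ N) (θ) : ∃ D : SU N, ∀ n, dist1 (D ^ n) = ‖2 · sin(nθ∕2)‖` (`D = diag(e^{iθ}, e^{−iθ}, 1, …, 1)`; `Matrix.l2_opNorm_diagonal`,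
`Complex.norm_exp_I_mul_ofReal_sub_one`) — the flux quantum the floor plants on every `01`-plaquette —, `eq_one_of_dist1_eq_zero`.
§2 walk bookkeeping on the torus: `walkEnd_cover` (`walkEnd (π z) w = π(z + netDisp w)`), `cover_mem_cubeEnl_zero_of_box`, `length_walk`, `bonds_replicate_true_subset` ∕
`bonds_replicate_false_subset` (a straight segment from a box point stays in the grid cube of index `0`), ★ `bonds_rectWord_subset` (every bond of the `s × s` square
`T4ReflectionCone.rectWord μ₁ μ₂ s s` from `π(0)` has both endpoints in `cubeEnl P S 0 0` once `s + 1 ≤ S`).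

HONEST FRAMING: [folklore] matrix ∕ lattice bookkeeping on the tree's own objects; nothing of Bałaban asserted or refuted; K0⁶ neither discharged nor refuted; counts unmoved (typed 28∕28 ·
discharged 5∕28); one finite `𝕋⁴` torus family at fixed `ε = L^{−K}`; not continuum ∕ OS ∕ mass gap ∕ Clay.  THEOREMS ONLY: no `def`, `instance`, `notation`, `sorry`; standard axioms.
DEPENDENCES (by name): FILE 25A `K0UniformFluxConfig.mem_walk_replicate_true ∕ mem_walk_replicate_false`, this lineage's FILE 12 `shift_cover`, dag-n07-e `dist1_su_eq_norm`, `T4Continuum.walk ∕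
walkEnd ∕ walkEnd_apply`, `BlockAveraging`'s `walk_append`, `T4ReflectionCone.rectWord ∕ netDisp_replicate ∕ netDisp_append`, `B15Eq112TorusCover.cover`, Mathlib `Matrix.l2_opNorm_diagonal`.
-/

noncomputable section

open scoped Matrix.Norms.L2Operator

namespace Summit.QuantumFields.YangMills.Theorems.K0Gauge152FluxGeometry

open Literature.MathematicalPhysics.QuantumFieldTheory.Balaban1983to89
open Literature.MathematicalPhysics.QuantumFieldTheory.Balaban1983to89.Node00
open Literature.MathematicalPhysics.QuantumFieldTheory.Balaban1983to89.T4Continuum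
open B15Eq112TorusCover B14DomainGeom B15DeterminingSets B12RegularSpaces111
open Summit.QuantumFields.YangMills.Theorems.K0BgProvisoOverRange (shift_cover)
open Summit.QuantumFields.YangMills.Theorems.K0TopIndexWrapGeometry (exists_seq_top zero_mem_cubeIndices)
open Summit.QuantumFields.YangMills.Theorems.K0VariationalThm1GaugeWrap (norm_expI_sub_one_le eta_nonneg_le_one)
open Summit.QuantumFields.YangMills.Theorems.K0UniformFluxConfig

/-! ## §1  A one-parameter diagonal subgroup of `SU(N)`: `D_θ = diag(e^{iθ}, e^{−iθ}, 1, …, 1)`, `dist1 (D_θ^n) = |2 sin(nθ∕2)|` -/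
section Diagonal

variable {N : ℕ} [NeZero N]

/-- For `N ≥ 2` and every angle `θ`: `D_θ = diag(e^{iθ}, e^{−iθ}, 1, …, 1) ∈ SU(N)` has `dist1 (D_θ ^ n) = ‖e^{inθ} − 1‖ = |2 sin(nθ∕2)|` for every `n`. [folklore] -/
theorem exists_su_diag (hN : 2 ≤ N) (θ : ℝ) : ∃ D : SU N, ∀ n : ℕ, dist1 (D ^ n) = ‖2 * Real.sin (n * θ / 2)‖ := by
  obtain ⟨n0, rfl⟩ : ∃ n, N = n + 2 := ⟨N - 2, by omega⟩
  set z : ℂ := Complex.exp (Complex.I * θ) with hz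
  set z' : ℂ := Complex.exp (-(Complex.I * θ)) with hz'
  have hzz' : z * z' = 1 := by rw [hz, hz', ← Complex.exp_add, add_neg_cancel, Complex.exp_zero]
  have hz'z : z' * z = 1 := by rw [mul_comm, hzz']
  have hconj : (starRingEnd ℂ) z = z' := by
    rw [hz, hz', ← Complex.exp_conj, map_mul, Complex.conj_I, Complex.conj_ofReal, neg_mul]
  have hconj' : (starRingEnd ℂ) z' = z := by
    rw [← hconj, starRingEnd_self_apply]
  set v : Fin (n0 + 2) → ℂ := fun i => if i = 0 then z else if i = 1 then z' else 1 with hv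
  have hv0 : v 0 = z := by simp [hv]
  have hv1 : v 1 = z' := by simp [hv]
  have hvss : ∀ i : Fin n0, v i.succ.succ = 1 := fun i => by
    have h0 : i.succ.succ ≠ 0 := Fin.succ_ne_zero _
    have h1 : i.succ.succ ≠ 1 := fun h => Fin.succ_ne_zero i (Fin.succ_injective _ (h.trans Fin.succ_zero_eq_one.symm))
    simp [hv, h0, h1]
  set A : Matrix (Fin (n0 + 2)) (Fin (n0 + 2)) ℂ := Matrix.diagonal v with hA
  have hstar : ∀ i, v i * star (v i) = 1 := by
    intro i
    refine Fin.cases ?_ (fun i' => Fin.cases ?_ (fun i'' => ?_) i') i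
    · rw [hv0]; show z * (starRingEnd ℂ) z = 1; rw [hconj, hzz']
    · show v 1 * star (v 1) = 1
      rw [hv1]; show z' * (starRingEnd ℂ) z' = 1; rw [hconj', hz'z]
    · rw [hvss]; simp
  have hunit : A ∈ Matrix.unitaryGroup (Fin (n0 + 2)) ℂ := by
    rw [Matrix.mem_unitaryGroup_iff, hA, Matrix.star_eq_conjTranspose, Matrix.diagonal_conjTranspose, Matrix.diagonal_mul_diagonal,
      ← Matrix.diagonal_one]
    congr 1
    funext i
    exact hstar i
  have hdet : A.det = 1 := by
    rw [hA, Matrix.det_diagonal, Fin.prod_univ_succ, Fin.prod_univ_succ, hv0]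
    simp only [Fin.succ_zero_eq_one, hv1, hvss, Finset.prod_const_one, mul_one]
    exact hzz'
  refine ⟨⟨A, Matrix.mem_specialUnitaryGroup_iff.mpr ⟨hunit, hdet⟩⟩, fun n => ?_⟩
  show ‖((⟨A, _⟩ : SU (n0 + 2)) ^ n : SU (n0 + 2)).1 - 1‖ = _
  rw [SubmonoidClass.coe_pow]
  show ‖A ^ n - 1‖ = _
  have hsub : A ^ n - 1 = Matrix.diagonal (v ^ n - 1) := by
    rw [hA, Matrix.diagonal_pow, ← Matrix.diagonal_one, Matrix.diagonal_sub]; rfl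
  rw [hsub, Matrix.l2_opNorm_diagonal]
  -- the two nontrivial entries have norm `|2 sin(nθ/2)|`
  have hzn : ‖z ^ n - 1‖ = ‖2 * Real.sin (n * θ / 2)‖ := by
    rw [hz, ← Complex.exp_nat_mul, ← mul_assoc, mul_comm (n : ℂ) Complex.I, mul_assoc]
    have : Complex.I * ((n : ℂ) * (θ : ℂ)) = Complex.I * ((n * θ : ℝ) : ℂ) := by push_cast; ring
    rw [this, Complex.norm_exp_I_mul_ofReal_sub_one]
  have hz'n : ‖z' ^ n - 1‖ = ‖2 * Real.sin (n * θ / 2)‖ := by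
    rw [hz', ← Complex.exp_nat_mul]
    have : (n : ℂ) * -(Complex.I * (θ : ℂ)) = Complex.I * ((-(n * θ) : ℝ) : ℂ) := by push_cast; ring
    rw [this, Complex.norm_exp_I_mul_ofReal_sub_one]
    rw [show -(↑n * θ) / 2 = -(↑n * θ / 2) by ring, Real.sin_neg, mul_neg, norm_neg]
  have hentry : ∀ i, ‖(v ^ n - 1) i‖ ≤ ‖2 * Real.sin (n * θ / 2)‖ := by
    intro i
    refine Fin.cases ?_ (fun i' => Fin.cases ?_ (fun i'' => ?_) i') i
    · show ‖v 0 ^ n - 1‖ ≤ _; rw [hv0, hzn]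
    · show ‖v 1 ^ n - 1‖ ≤ _; rw [hv1, hz'n]
    · show ‖v i''.succ.succ ^ n - 1‖ ≤ _; rw [hvss]; simp
  refine le_antisymm ((pi_norm_le_iff_of_nonneg (norm_nonneg _)).mpr hentry) ?_
  calc ‖2 * Real.sin (n * θ / 2)‖ = ‖(v ^ n - 1) 0‖ := by show _ = ‖v 0 ^ n - 1‖; rw [hv0, hzn]
    _ ≤ ‖v ^ n - 1‖ := norm_le_pi_norm _ 0

/-- `dist1 g = 0` forces `g = 1` in `SU(N)` (`dist1 g = ‖g − 1‖`). [folklore] -/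
theorem eq_one_of_dist1_eq_zero (g : SU N) (h : dist1 g = 0) : g = 1 := by
  rw [dist1_su_eq_norm, norm_eq_zero, sub_eq_zero] at h
  exact Subtype.ext h

end Diagonal

/-! ## §2  Walk bookkeeping on the torus: ends of walks from `π(z)`, box membership, the square's bonds lie in the cube -/
section Walks

variable {P : Params}

/-- The end of a walk from `π(z)` is `π(z + netDisp w)`. [folklore] -/
theorem walkEnd_cover (z : Pt P.d) (w : List (Letter P.d)) : walkEnd (cover P z) w = cover P (fun ν => z ν + netDisp w ν) := by
  funext ν
  rw [walkEnd_apply]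
  simp [cover, Int.cast_add]

/-- A lattice point of the box `[0, S−1]ᵈ` covers into the grid cube of side `S` and index `0`. [cite: Balaban1988Convergent, (2.17) p.257 (bookkeeping)] -/
theorem cover_mem_cubeEnl_zero_of_box {S : ℕ} {w : Pt P.d} (hw : ∀ κ, 0 ≤ w κ ∧ w κ + 1 ≤ S) : cover P w ∈ cubeEnl P S 0 0 := by
  refine ⟨w, fun κ => ?_, rfl⟩
  obtain ⟨h0, h1⟩ := hw κ
  simp only [Pi.zero_apply, mul_zero, Nat.zero_mul, Nat.cast_zero, sub_zero, add_zero, zero_add]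
  exact ⟨h0, by linarith⟩

/-- The length of a walk is the length of its word. [folklore] -/
theorem length_walk : ∀ (x : Site P 0) (w : List (Letter P.d)), (walk x w).length = w.length
  | _, [] => rfl
  | x, (μ, true) :: w => by
      show (⟨⟨x, μ⟩, true⟩ :: walk (x.shift μ) w : List (LStep P 0)).length = _
      rw [List.length_cons, length_walk, List.length_cons]
  | x, (μ, false) :: w => by
      show (⟨⟨x.unshift μ, μ⟩, false⟩ :: walk (x.unshift μ) w : List (LStep P 0)).length = _
      rw [List.length_cons, length_walk, List.length_cons]

/-- The bonds of a forward straight segment `(+e_μ)^n` from `π(z)` lie in the grid cube of side `S` (index `0`) when `z` is in the box and `z_μ + n + 1 ≤ S`.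
[cite: Balaban1987RG1, (1.12) p.262 (bookkeeping: bonds of a cube)] -/
theorem bonds_replicate_true_subset {S : ℕ} {z : Pt P.d} (hz : ∀ κ, 0 ≤ z κ ∧ z κ + 1 ≤ S) (μ : Fin P.d) {n : ℕ} (hn : z μ + n + 1 ≤ S) :
    ∀ st ∈ walk (cover P z) (List.replicate n (μ, true)), st.bond ∈ (Sect2.regionOfSet P (cubeEnl P S 0 0)).bonds := by
  intro st hst
  obtain ⟨i, hi, hb⟩ := mem_walk_replicate_true μ n z st hst
  rw [hb]
  have hi' : (i : ℤ) < n := by exact_mod_cast hi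
  refine ⟨cover_mem_cubeEnl_zero_of_box fun κ => ?_, ?_⟩
  · by_cases h : κ = μ
    · subst h; simp only [Function.update_self]; constructor <;> linarith [(hz κ).1]
    · rw [Function.update_of_ne h]; exact hz κ
  · show (cover P (Function.update z μ (z μ + i))).shift μ ∈ _
    rw [shift_cover]
    refine cover_mem_cubeEnl_zero_of_box fun κ => ?_
    by_cases h : κ = μ
    · subst h; simp only [Function.update_self]; constructor <;> linarith [(hz κ).1]
    · rw [Function.update_of_ne h, Function.update_of_ne h]; exact hz κ

/-- The bonds of a backward straight segment `(−e_μ)^n` from `π(z)` lie in the grid cube of side `S` (index `0`) when `z` is in the box and `n ≤ z_μ`.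
[cite: Balaban1987RG1, (1.12) p.262 (bookkeeping: bonds of a cube)] -/
theorem bonds_replicate_false_subset {S : ℕ} {z : Pt P.d} (hz : ∀ κ, 0 ≤ z κ ∧ z κ + 1 ≤ S) (μ : Fin P.d) {n : ℕ} (hn : (n : ℤ) ≤ z μ) :
    ∀ st ∈ walk (cover P z) (List.replicate n (μ, false)), st.bond ∈ (Sect2.regionOfSet P (cubeEnl P S 0 0)).bonds := by
  intro st hst
  obtain ⟨i, hi, hb⟩ := mem_walk_replicate_false μ n z st hst
  rw [hb]
  have hi' : (i : ℤ) + 1 ≤ n := by exact_mod_cast hi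
  refine ⟨cover_mem_cubeEnl_zero_of_box fun κ => ?_, ?_⟩
  · by_cases h : κ = μ
    · subst h; simp only [Function.update_self]; constructor <;> linarith [(hz κ).2]
    · rw [Function.update_of_ne h]; exact hz κ
  · show (cover P (Function.update z μ (z μ - (i + 1)))).shift μ ∈ _
    rw [shift_cover]
    refine cover_mem_cubeEnl_zero_of_box fun κ => ?_
    by_cases h : κ = μ
    · subst h; simp only [Function.update_self]; constructor <;> linarith [(hz κ).2]
    · rw [Function.update_of_ne h, Function.update_of_ne h]; exact hz κ

/-- **The `s × s` square from `π(0)` in the `μ₁μ₂`-plane lies in the grid cube of side `S ≥ s + 1` and index `0`**: every bond of `walk (π 0) (rectWord μ₁ μ₂ s s)` has both endpoints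
in `cubeEnl P S 0 0`. [cite: Balaban1987RG1, (1.12) p.262 (bookkeeping: a Wilson square inside a cube)] -/
theorem bonds_rectWord_subset {μ₁ μ₂ : Fin P.d} (hne : μ₁ ≠ μ₂) {s S : ℕ} (hsS : s + 1 ≤ S) :
    ∀ st ∈ walk (cover P 0) (T4ReflectionCone.rectWord μ₁ μ₂ s s), st.bond ∈ (Sect2.regionOfSet P (cubeEnl P S 0 0)).bonds := by
  have hsS' : (s : ℤ) + 1 ≤ S := by exact_mod_cast hsS
  have hs0 : (0 : ℤ) ≤ s := by positivity
  -- net displacements of straight runs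
  have hnd : ∀ (μ : Fin P.d) (b : Bool) (κ : Fin P.d),
      netDisp (List.replicate s (μ, b)) κ = if μ = κ then (if b then (s : ℤ) else -s) else 0 := by
    intro μ b κ
    rw [T4ReflectionCone.netDisp_replicate]
    split_ifs <;> simp
  unfold T4ReflectionCone.rectWord
  intro st hst
  rw [walk_append, walk_append, walk_append, walkEnd_cover, walkEnd_cover, walkEnd_cover] at hst
  simp only [List.mem_append] at hst
  rcases hst with ((h1 | h2) | h3) | h4
  · exact bonds_replicate_true_subset (z := 0) (fun κ => by simp; omega) μ₁ (by simp; omega) st h1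
  · refine bonds_replicate_true_subset (fun κ => ?_) μ₂ ?_ st h2
    · simp only [Pi.zero_apply, zero_add, hnd]
      by_cases ha : μ₁ = κ
      · simp only [if_pos ha, if_true]; constructor <;> linarith
      · simp only [if_neg ha]; constructor <;> linarith
    · simp only [Pi.zero_apply, zero_add, hnd, if_neg hne]; linarith
  · refine bonds_replicate_false_subset (fun κ => ?_) μ₁ ?_ st h3
    · simp only [Pi.zero_apply, zero_add, T4ReflectionCone.netDisp_append, hnd]
      by_cases ha : μ₁ = κ
      · have hb : ¬ μ₂ = κ := fun h => hne (ha.trans h.symm)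
        simp only [if_pos ha, if_neg hb, if_true]; constructor <;> linarith
      · by_cases hb : μ₂ = κ
        · simp only [if_neg ha, if_pos hb, if_true]; constructor <;> linarith
        · simp only [if_neg ha, if_neg hb]; constructor <;> linarith
    · simp only [Pi.zero_apply, zero_add, T4ReflectionCone.netDisp_append, hnd, if_neg (Ne.symm hne), if_true]; linarith
  · refine bonds_replicate_false_subset (fun κ => ?_) μ₂ ?_ st h4
    · simp only [Pi.zero_apply, zero_add, T4ReflectionCone.netDisp_append, hnd]
      by_cases ha : μ₁ = κ
      · have hb : ¬ μ₂ = κ := fun h => hne (ha.trans h.symm)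
        simp only [if_pos ha, if_neg hb, if_true, Bool.false_eq_true, if_false]; constructor <;> linarith
      · by_cases hb : μ₂ = κ
        · simp only [if_neg ha, if_pos hb, if_true]; constructor <;> linarith
        · simp only [if_neg ha, if_neg hb]; constructor <;> linarith
    · simp only [Pi.zero_apply, zero_add, T4ReflectionCone.netDisp_append, hnd, if_neg hne, if_true, Bool.false_eq_true,
        if_false]; linarith

end Walks


end Summit.QuantumFields.YangMills.Theorems.K0Gauge152FluxGeometry

end
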